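import Summits.QuantumFields.YangMills.Theses.ParabolicTrajectory
import Literature.MathematicalPhysics.QuantumFieldTheory.BalabanBanachStep
import Summits.QuantumFields.YangMills.Theorems.ParabolicTrajectoryLatticeGapOnTrajectoryScalingDefs

/-!
# Crux `LatticeGapOnTrajectory` (stmt-QuantumFields-10523), line `trajectory-gap-scaling`:
# `stub_tubeVisited : TubeVisited` (λ-lemma entrance)
For `S : BalabanBanachStep G r M'`, curve data `IsCurveData S δ' K θ₁ C' h`, a window `0 < γ`,
`γ + 2bγ³ ≤ γ' ≤ δ'` and `0 < ε`, every large `β` is `betaOf g` for a Wilson point whose orbit has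
in-chart history, coupling `< γ` before its FIRST passage `j` of `γ`, and lands in
`tube S h γ γ' ε` at `j`. PHASE 1 (basin: coupling frozen below a ceiling `η`, fibre contracted into
the `δ'`-ball); PHASE 2 (`δ'`-bichart: monotone drift `(b/2)g³ ≤ φ g y − g ≤ (3b/2)g³` from the
`remainder` bound with `4Cδ' ≤ b`, `2Cδ' ≤ 1 − θ`; first passage by `Nat.find`); ATTRACTION over
`> N` bichart steps; IVT for `betaOf`. Helpers `tvLocal_*` are `private` copies of the public `tubeVisited_*` lemmas of
`…StubTubeVisitedSteps.lean` (identical statements), so this file builds without that module.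
-/

open scoped SchwartzMap
open MeasureTheory Filter Topology Literature.MathematicalPhysics.QuantumFieldTheory
open Literature.MathematicalPhysics.QuantumLattice Summit.QuantumFields.YangMills.Theses.ParabolicTrajectory

noncomputable section

namespace Summit.QuantumFields.YangMills.Cruxes.LatticeGapOnTrajectory.TrajectoryGapScaling
variable {G : Type} [Group G] [TopologicalSpace G] [IsTopologicalGroup G] [CompactSpace G]
  [MeasurableSpace G] [BorelSpace G] {r : LatticeRep G} {M : ℕ} (S : BalabanBanachStep G r M)
/-- Membership in the chart `[0, δ] × B̄_R`, from the two coordinate bounds. -/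
private theorem tvLocal_mem_chart {p : ℝ × S.E} (h1 : p.1 ∈ Set.Icc 0 S.δ)
    (h2 : ‖p.2‖ ≤ S.R) : p ∈ chart S := by
  simp only [chart, Set.mem_prod, Metric.mem_closedBall, dist_zero_right]
  exact ⟨h1, h2⟩
/-- Basin step (phase 1): `|φ g y − g| ≤ (b + C(δ' + R)) g³` for `0 ≤ g ≤ δ' ≤ δ`, `‖y‖ ≤ R`. -/
private theorem tvLocal_basin_coupling {δ' g : ℝ} {y : S.E} (hδ'δ : δ' ≤ S.δ) (hg0 : 0 ≤ g)
    (hgδ' : g ≤ δ') (hy : ‖y‖ ≤ S.R) :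
    |S.φ g y - g| ≤ (S.b + S.C * (δ' + S.R)) * g ^ 3 := by
  have hgδ : |g| ≤ S.δ := by rw [abs_of_nonneg hg0]; exact hgδ'.trans hδ'δ
  have h := S.abs_φ_sub_le hgδ hy
  rw [abs_of_nonneg hg0] at h
  have hC := S.C_pos.le
  have hg3 : 0 ≤ g ^ 3 := by positivity
  have hg4 : g ^ 4 ≤ δ' * g ^ 3 := by
    have : g ^ 4 = g * g ^ 3 := by ring
    rw [this]
    exact mul_le_mul_of_nonneg_right hgδ' hg3
  calc |S.φ g y - g| ≤ S.b * g ^ 3 + S.C * (g ^ 4 + g ^ 3 * S.R) := h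
    _ ≤ S.b * g ^ 3 + S.C * (δ' * g ^ 3 + g ^ 3 * S.R) := by gcongr
    _ = (S.b + S.C * (δ' + S.R)) * g ^ 3 := by ring
/-- Bichart drift (phase 2): `g + (b/2)g³ ≤ φ g y ≤ g + (3b/2)g³` under `4Cδ' ≤ b`, `‖y‖ ≤ δ'`. -/
private theorem tvLocal_bichart_coupling {δ' g : ℝ} {y : S.E} (hδ'δ : δ' ≤ S.δ)
    (hmargin : 4 * S.C * δ' ≤ S.b) (hg0 : 0 ≤ g) (hgδ' : g ≤ δ') (hy : ‖y‖ ≤ δ') :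
    g + S.b / 2 * g ^ 3 ≤ S.φ g y ∧ S.φ g y ≤ g + 3 * S.b / 2 * g ^ 3 := by
  have hgδ : |g| ≤ S.δ := by rw [abs_of_nonneg hg0]; exact hgδ'.trans hδ'δ
  have hrem := (S.remainder g y hgδ (hy.trans hδ'δ)).1
  rw [abs_of_nonneg hg0] at hrem
  obtain ⟨h1, h2⟩ := abs_le.1 hrem
  have hC := S.C_pos.le
  have hg3 : 0 ≤ g ^ 3 := by positivity
  have key : S.C * (g ^ 4 + g ^ 3 * ‖y‖) ≤ S.b / 2 * g ^ 3 := by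
    calc S.C * (g ^ 4 + g ^ 3 * ‖y‖) ≤ S.C * (g ^ 4 + g ^ 3 * δ') := by gcongr
      _ = S.C * (g + δ') * g ^ 3 := by ring
      _ ≤ S.C * (δ' + δ') * g ^ 3 := by gcongr
      _ = 4 * S.C * δ' / 2 * g ^ 3 := by ring
      _ ≤ S.b / 2 * g ^ 3 := by gcongr
  constructor <;> linarith
/-- Bichart fibre invariance (phase 2): `‖Ψ g y‖ ≤ θδ' + 2Cδ'² ≤ δ'` under `2Cδ' ≤ 1 − θ`. -/
private theorem tvLocal_bichart_fibre {δ' g : ℝ} {y : S.E} (hδ'δ : δ' ≤ S.δ)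
    (hmargin : 2 * S.C * δ' ≤ 1 - S.θ) (hg0 : 0 ≤ g) (hgδ' : g ≤ δ') (hy : ‖y‖ ≤ δ') :
    ‖S.Ψ g y‖ ≤ δ' := by
  have hgδ : |g| ≤ S.δ := by rw [abs_of_nonneg hg0]; exact hgδ'.trans hδ'δ
  have hrem := (S.remainder g y hgδ (hy.trans hδ'δ)).2; have hC := S.C_pos.le; have hθ := S.θ_nonneg
  have hδ'0 : 0 ≤ δ' := hg0.trans hgδ'
  have hA : ‖S.A y‖ ≤ S.θ * δ' :=
    calc ‖S.A y‖ ≤ ‖S.A‖ * ‖y‖ := S.A.le_opNorm y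
      _ ≤ S.θ * δ' := mul_le_mul S.norm_A_le hy (norm_nonneg _) hθ
  have hg2 : g ^ 2 ≤ δ' ^ 2 := pow_le_pow_left₀ hg0 hgδ' 2
  have hy2 : ‖y‖ ^ 2 ≤ δ' ^ 2 := pow_le_pow_left₀ (norm_nonneg _) hy 2
  calc ‖S.Ψ g y‖ = ‖(S.Ψ g y - S.A y) + S.A y‖ := by rw [sub_add_cancel]
    _ ≤ ‖S.Ψ g y - S.A y‖ + ‖S.A y‖ := norm_add_le _ _
    _ ≤ S.C * (g ^ 2 + ‖y‖ ^ 2) + S.θ * δ' := add_le_add hrem hA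
    _ ≤ S.C * (δ' ^ 2 + δ' ^ 2) + S.θ * δ' := by gcongr
    _ = 2 * S.C * δ' * δ' + S.θ * δ' := by ring
    _ ≤ (1 - S.θ) * δ' + S.θ * δ' := by gcongr
    _ = δ' := by ring
/-- `betaOf` is onto every large `β` (IVT: continuity on `(0, g₀]`, `→ ∞` at `0⁺`). -/
private theorem tvLocal_exists_wilson_point {g₁ : ℝ} (h0 : 0 < g₁) (h1 : g₁ ≤ S.g₀) :
    ∃ β₁ : ℝ, ∀ β : ℝ, β₁ ≤ β → ∃ g ∈ Set.Ioc 0 g₁, S.betaOf g = β := by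
  refine ⟨S.betaOf g₁, fun β hβ => ?_⟩
  have hev : ∀ᶠ g in 𝓝[>] (0 : ℝ), β ≤ S.betaOf g := S.tendsto_betaOf.eventually_ge_atTop β
  have hev' : ∀ᶠ g in 𝓝[>] (0 : ℝ), g ∈ Set.Ioo 0 g₁ := Ioo_mem_nhdsGT h0
  obtain ⟨ε, hε, hεI⟩ := (hev.and hev').exists
  have hcont : ContinuousOn S.betaOf (Set.Icc ε g₁) :=
    S.continuousOn_betaOf.mono fun x hx => ⟨hεI.1.trans_le hx.1, hx.2.trans h1⟩
  obtain ⟨g, hg, hgβ⟩ := intermediate_value_Icc' hεI.2.le hcont ⟨hβ, hε⟩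
  exact ⟨g, ⟨hεI.1.trans_le hg.1, hg.2⟩, hgβ⟩
/-- Phase-1 step: below the ceiling `η` the coupling stays positive, grows by `≤ (1 + cγ²)`, and the
fibre stays in the `R`-ball with `‖Ψ g y‖ ≤ θ'‖y‖ + (1 − θ')δ'/2`. -/
private theorem tvLocal_step1 {δ' η c γ : ℝ} (hδ'δ : δ' ≤ S.δ) (hηδ' : η ≤ δ') (hηγ : η ≤ γ)
    (hc : S.b + S.C * (δ' + S.R) ≤ c) (hc0 : 0 ≤ c) (hcη : c * η ^ 2 ≤ 1 / 2)
    (hCη : 2 * S.C * η ^ 2 ≤ (1 - S.θ') * δ') {q : ℝ × S.E} (hq0 : 0 < q.1) (hqη : q.1 ≤ η)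
    (hqy : ‖q.2‖ ≤ S.R) :
    0 < (S.F q).1 ∧ (S.F q).1 ≤ q.1 * (1 + c * γ ^ 2) ∧ ‖(S.F q).2‖ ≤ S.R ∧
      ‖(S.F q).2‖ ≤ S.θ' * ‖q.2‖ + (1 - S.θ') * δ' / 2 := by
  show 0 < S.φ q.1 q.2 ∧ S.φ q.1 q.2 ≤ q.1 * (1 + c * γ ^ 2) ∧ ‖S.Ψ q.1 q.2‖ ≤ S.R ∧
    ‖S.Ψ q.1 q.2‖ ≤ S.θ' * ‖q.2‖ + (1 - S.θ') * δ' / 2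
  have hC := S.C_pos; have hθ1 := S.θ'_lt_one; have hδ'R : δ' ≤ S.R := hδ'δ.trans S.δ_le_R
  have hqδ' : q.1 ≤ δ' := hqη.trans hηδ'
  have hqδ : |q.1| ≤ S.δ := by rw [abs_of_pos hq0]; exact hqδ'.trans hδ'δ
  obtain ⟨hlo, hhi⟩ := abs_le.1 (tvLocal_basin_coupling S hδ'δ hq0.le hqδ' hqy)
  have hq1 : 0 ≤ q.1 := hq0.le
  have hq3 : 0 ≤ q.1 ^ 3 := by positivity
  have hq2 : q.1 ^ 2 ≤ η ^ 2 := pow_le_pow_left₀ hq1 hqη 2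
  have hq2γ : q.1 ^ 2 ≤ γ ^ 2 := pow_le_pow_left₀ hq1 (hqη.trans hηγ) 2
  have hdev : (S.b + S.C * (δ' + S.R)) * q.1 ^ 3 ≤ c * q.1 ^ 2 * q.1 :=
    calc (S.b + S.C * (δ' + S.R)) * q.1 ^ 3 ≤ c * q.1 ^ 3 := mul_le_mul_of_nonneg_right hc hq3
      _ = c * q.1 ^ 2 * q.1 := by ring
  have hlow : (S.b + S.C * (δ' + S.R)) * q.1 ^ 3 ≤ q.1 / 2 :=
    calc (S.b + S.C * (δ' + S.R)) * q.1 ^ 3 ≤ c * q.1 ^ 2 * q.1 := hdev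
      _ ≤ c * η ^ 2 * q.1 := by gcongr
      _ ≤ 1 / 2 * q.1 := mul_le_mul_of_nonneg_right hcη hq1
      _ = q.1 / 2 := by ring
  have hup : (S.b + S.C * (δ' + S.R)) * q.1 ^ 3 ≤ c * γ ^ 2 * q.1 :=
    calc (S.b + S.C * (δ' + S.R)) * q.1 ^ 3 ≤ c * q.1 ^ 2 * q.1 := hdev
      _ ≤ c * γ ^ 2 * q.1 := by gcongr
  have hKq : q.1 * (1 + c * γ ^ 2) = q.1 + c * γ ^ 2 * q.1 := by ring
  have hCq : S.C * q.1 ^ 2 ≤ (1 - S.θ') * δ' / 2 := by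
    have := mul_le_mul_of_nonneg_left hq2 hC.le
    linarith
  have hCqR : S.C * q.1 ^ 2 ≤ (1 - S.θ') * S.R := by
    refine hCq.trans ?_
    calc (1 - S.θ') * δ' / 2 = (1 - S.θ') * (δ' / 2) := by ring
      _ ≤ (1 - S.θ') * S.R := mul_le_mul_of_nonneg_left (by linarith) (by linarith)
  refine ⟨by linarith, by linarith, S.norm_Ψ_le_R hqδ hqy hCqR, ?_⟩
  have := S.norm_Ψ_le hqδ hqy
  linarith
/-- Phase-2 step below `γ`: drift `g + (b/2)g³ ≤ φ g y ≤ min γ' (g(1 + cγ²))`, fibre `≤ δ'`. -/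
private theorem tvLocal_step2 {δ' γ γ' c : ℝ} (hδ'δ : δ' ≤ S.δ) (hdrift : 4 * S.C * δ' ≤ S.b)
    (hfib : 2 * S.C * δ' ≤ 1 - S.θ) (hγγ' : γ + 2 * S.b * γ ^ 3 ≤ γ') (hγδ' : γ ≤ δ')
    (hc : 3 * S.b / 2 ≤ c) {q : ℝ × S.E} (hq0 : 0 < q.1) (hqγ : q.1 < γ) (hqy : ‖q.2‖ ≤ δ') :
    q.1 + S.b / 2 * q.1 ^ 3 ≤ (S.F q).1 ∧ (S.F q).1 ≤ γ' ∧ (S.F q).1 ≤ q.1 * (1 + c * γ ^ 2) ∧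
      ‖(S.F q).2‖ ≤ δ' := by
  show q.1 + S.b / 2 * q.1 ^ 3 ≤ S.φ q.1 q.2 ∧ S.φ q.1 q.2 ≤ γ' ∧
    S.φ q.1 q.2 ≤ q.1 * (1 + c * γ ^ 2) ∧ ‖S.Ψ q.1 q.2‖ ≤ δ'
  have hb := S.b_pos; have hq1 : 0 ≤ q.1 := hq0.le; have hγ0 : 0 ≤ γ := hq1.trans hqγ.le
  have hqδ' : q.1 ≤ δ' := hqγ.le.trans hγδ'
  have hc0 : 0 ≤ c := le_trans (by positivity) hc
  obtain ⟨hlo, hhi⟩ := tvLocal_bichart_coupling S hδ'δ hdrift hq1 hqδ' hqy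
  refine ⟨hlo, ?_, ?_, tvLocal_bichart_fibre S hδ'δ hfib hq1 hqδ' hqy⟩
  · have h3 : q.1 ^ 3 ≤ γ ^ 3 := pow_le_pow_left₀ hq1 hqγ.le 3
    have hbq : 3 * S.b / 2 * q.1 ^ 3 ≤ 3 * S.b / 2 * γ ^ 3 :=
      mul_le_mul_of_nonneg_left h3 (by positivity)
    have hγ3 : 0 ≤ S.b * γ ^ 3 := by positivity
    linarith
  · have hq2γ : q.1 ^ 2 ≤ γ ^ 2 := pow_le_pow_left₀ hq1 hqγ.le 2
    have hup : 3 * S.b / 2 * q.1 ^ 3 ≤ c * γ ^ 2 * q.1 :=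
      calc 3 * S.b / 2 * q.1 ^ 3 = 3 * S.b / 2 * q.1 ^ 2 * q.1 := by ring
        _ ≤ c * γ ^ 2 * q.1 := by gcongr
    have hKq : q.1 * (1 + c * γ ^ 2) = q.1 + c * γ ^ 2 * q.1 := by ring
    linarith
/-- Phase-1 invariant along the Wilson orbit up to a horizon `L` with `g (1 + cγ²)^L ≤ η`. -/
private theorem tvLocal_phase1 {δ' η c γ : ℝ} (hδ' : 0 < δ') (hδ'δ : δ' ≤ S.δ) (hηδ' : η ≤ δ')
    (hηγ : η ≤ γ) (hc : S.b + S.C * (δ' + S.R) ≤ c) (hc0 : 0 ≤ c) (hcη : c * η ^ 2 ≤ 1 / 2)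
    (hCη : 2 * S.C * η ^ 2 ≤ (1 - S.θ') * δ') {g : ℝ} (hg0 : 0 < g) (hgg₀ : g ≤ S.g₀) {L : ℕ}
    (hgL : g * (1 + c * γ ^ 2) ^ L ≤ η) :
    ∀ l ≤ L, 0 < (S.F^[l] (g, S.yW g)).1 ∧ (S.F^[l] (g, S.yW g)).1 ≤ g * (1 + c * γ ^ 2) ^ l ∧
      ‖(S.F^[l] (g, S.yW g)).2‖ ≤ S.R ∧
      ‖(S.F^[l] (g, S.yW g)).2‖ ≤ S.θ' ^ l * S.R + δ' / 2 := by
  have hθ0 := S.θ'_nonneg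
  set Kg : ℝ := 1 + c * γ ^ 2 with hKg
  have hK1 : 1 ≤ Kg := by linarith [show (0 : ℝ) ≤ c * γ ^ 2 by positivity]
  have hK0 : 0 ≤ Kg := by linarith
  have hy0 : ‖S.yW g‖ ≤ S.R := S.norm_yW_le g ⟨hg0.le, hgg₀⟩
  intro l
  induction l with
  | zero =>
    intro _
    refine ⟨hg0, by simp, hy0, ?_⟩
    simp only [Function.iterate_zero, id_eq, pow_zero, one_mul]
    linarith
  | succ l ih =>
    intro hl
    obtain ⟨h0, hgrow, hRl, hfib⟩ := ih (Nat.le_of_succ_le hl)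
    have hlη : (S.F^[l] (g, S.yW g)).1 ≤ η := by
      refine hgrow.trans (le_trans ?_ hgL)
      exact mul_le_mul_of_nonneg_left (pow_le_pow_right₀ hK1 (Nat.le_of_succ_le hl)) hg0.le
    obtain ⟨s0, sgrow, sR, sfib⟩ := tvLocal_step1 S hδ'δ hηδ' hηγ hc hc0 hcη hCη h0 hlη hRl
    rw [Function.iterate_succ_apply']
    refine ⟨s0, ?_, sR, ?_⟩
    · calc (S.F (S.F^[l] (g, S.yW g))).1 ≤ (S.F^[l] (g, S.yW g)).1 * Kg := sgrow
        _ ≤ g * Kg ^ l * Kg := mul_le_mul_of_nonneg_right hgrow hK0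
        _ = g * Kg ^ (l + 1) := by ring
    · calc ‖(S.F (S.F^[l] (g, S.yW g))).2‖
          ≤ S.θ' * ‖(S.F^[l] (g, S.yW g)).2‖ + (1 - S.θ') * δ' / 2 := sfib
        _ ≤ S.θ' * (S.θ' ^ l * S.R + δ' / 2) + (1 - S.θ') * δ' / 2 :=
            add_le_add (mul_le_mul_of_nonneg_left hfib hθ0) le_rfl
        _ = S.θ' ^ (l + 1) * S.R + δ' / 2 := by ring
/-- Phase-2 invariant from a bichart point while the couplings stay `< γ` (linear growth). -/
private theorem tvLocal_phase2 {δ' γ γ' c : ℝ} (hδ'δ : δ' ≤ S.δ) (hdrift : 4 * S.C * δ' ≤ S.b)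
    (hfib : 2 * S.C * δ' ≤ 1 - S.θ) (hγγ' : γ + 2 * S.b * γ ^ 3 ≤ γ') (hγδ' : γ ≤ δ')
    (hc : 3 * S.b / 2 ≤ c) {q : ℝ × S.E} (hq0 : 0 < q.1) (hqγ' : q.1 ≤ γ') (hqy : ‖q.2‖ ≤ δ') :
    ∀ n : ℕ, (∀ i < n, (S.F^[i] q).1 < γ) →
      0 < (S.F^[n] q).1 ∧ (S.F^[n] q).1 ≤ γ' ∧ ‖(S.F^[n] q).2‖ ≤ δ' ∧
        (S.F^[n] q).1 ≤ q.1 * (1 + c * γ ^ 2) ^ n ∧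
        q.1 + n * (S.b / 2 * q.1 ^ 3) ≤ (S.F^[n] q).1 := by
  have hb := S.b_pos
  have hc0 : 0 ≤ c := le_trans (by positivity) hc
  set Kg : ℝ := 1 + c * γ ^ 2 with hKg
  have hK0 : 0 ≤ Kg := by positivity
  intro n
  induction n with
  | zero =>
    intro _
    refine ⟨hq0, hqγ', hqy, by simp, by simp⟩
  | succ n ih =>
    intro H
    obtain ⟨h0, -, hyδ', hgrow, hlin⟩ := ih fun i hi => H i (Nat.lt_succ_of_lt hi)
    have hγn : (S.F^[n] q).1 < γ := H n (Nat.lt_succ_self n)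
    obtain ⟨slo, sγ', sgrow, sfib⟩ := tvLocal_step2 S hδ'δ hdrift hfib hγγ' hγδ' hc h0 hγn hyδ'
    rw [Function.iterate_succ_apply']
    have hcur : 0 ≤ (S.F^[n] q).1 := h0.le
    refine ⟨?_, sγ', sfib, ?_, ?_⟩
    · have : 0 ≤ S.b / 2 * (S.F^[n] q).1 ^ 3 := by positivity
      linarith
    · calc (S.F (S.F^[n] q)).1 ≤ (S.F^[n] q).1 * Kg := sgrow
        _ ≤ q.1 * Kg ^ n * Kg := mul_le_mul_of_nonneg_right hgrow hK0
        _ = q.1 * Kg ^ (n + 1) := by ring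
    · have hq3 : 0 ≤ S.b / 2 * q.1 ^ 3 := by positivity
      have hge : q.1 ≤ (S.F^[n] q).1 := by
        have : (0 : ℝ) ≤ n * (S.b / 2 * q.1 ^ 3) := by positivity
        linarith
      have hcube : q.1 ^ 3 ≤ (S.F^[n] q).1 ^ 3 := pow_le_pow_left₀ hq0.le hge 3
      have := mul_le_mul_of_nonneg_left hcube (by positivity : (0 : ℝ) ≤ S.b / 2)
      push_cast
      linarith
/-- Entrance of the small-coupling Wilson orbits into `tube S h γ γ' ε` at the first passage of `γ`,
with in-chart history (basin absorption, bichart drift, attraction). -/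
private theorem tubeVisited_orbit {δ' K θ₁ C' : ℝ} {h : ℝ → S.E}
    (hcd : IsCurveData S δ' K θ₁ C' h) {γ γ' ε : ℝ} (hγ : 0 < γ)
    (hγγ' : γ + 2 * S.b * γ ^ 3 ≤ γ') (hγ'δ' : γ' ≤ δ') (hε : 0 < ε) :
    ∃ g₁ : ℝ, 0 < g₁ ∧ g₁ ≤ S.g₀ ∧ ∀ g ∈ Set.Ioc 0 g₁, ∃ j : ℕ,
      (∀ i ≤ j, S.F^[i] (g, S.yW g) ∈ chart S) ∧
      (∀ i < j, (S.F^[i] (g, S.yW g)).1 < γ) ∧ S.F^[j] (g, S.yW g) ∈ tube S h γ γ' ε := by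
  obtain ⟨hδ', hδ'δ, hK, hθ₁, hθ₁1, -, hdriftM, hfibM, -, -, -, hhalf, -, hattr⟩ := hcd
  have hb := S.b_pos; have hC := S.C_pos; have hR := S.R_pos; have hθ1 := S.θ'_lt_one
  have h1θ : 0 < 1 - S.θ' := by linarith
  have hγγ'lt : γ < γ' := by
    have : 0 < 2 * S.b * γ ^ 3 := by positivity
    linarith
  have hγδ' : γ ≤ δ' := hγγ'lt.le.trans hγ'δ'; have hδ'R : δ' ≤ S.R := hδ'δ.trans S.δ_le_R
  set c₁ : ℝ := 2 * S.b + S.C * (δ' + S.R) with hc₁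
  have hCδR : 0 ≤ S.C * (δ' + S.R) := by positivity
  have hc₁pos : 0 < c₁ := by positivity
  have hc₁b : S.b + S.C * (δ' + S.R) ≤ c₁ := by linarith
  have hc₁b' : 3 * S.b / 2 ≤ c₁ := by linarith
  set Kg : ℝ := 1 + c₁ * γ ^ 2 with hKg
  have hKg1 : 1 ≤ Kg := by linarith [show (0 : ℝ) ≤ c₁ * γ ^ 2 by positivity]
  have hKg0 : 0 < Kg := by linarith
  set η : ℝ := min (min 1 (γ / 2)) (min (1 / (2 * c₁)) ((1 - S.θ') * δ' / (2 * S.C))) with hη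
  have hηpos : 0 < η :=
    lt_min (lt_min one_pos (by positivity)) (lt_min (by positivity) (by positivity))
  have hη1 : η ≤ 1 := (min_le_left _ _).trans (min_le_left _ _)
  have hηγ : η ≤ γ / 2 := (min_le_left _ _).trans (min_le_right _ _)
  have hηc : η ≤ 1 / (2 * c₁) := (min_le_right _ _).trans (min_le_left _ _)
  have hηC : η ≤ (1 - S.θ') * δ' / (2 * S.C) := (min_le_right _ _).trans (min_le_right _ _)
  have hη2 : η ^ 2 ≤ η := pow_le_of_le_one hηpos.le hη1 two_ne_zero
  have hηc' : c₁ * η ^ 2 ≤ 1 / 2 := by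
    have h1 : η * (2 * c₁) ≤ 1 := by
      have := hηc
      rwa [le_div_iff₀ (by positivity : (0 : ℝ) < 2 * c₁)] at this
    have h2 : c₁ * η ^ 2 ≤ c₁ * η := mul_le_mul_of_nonneg_left hη2 hc₁pos.le
    linarith
  have hηC' : 2 * S.C * η ^ 2 ≤ (1 - S.θ') * δ' := by
    have h1 : η * (2 * S.C) ≤ (1 - S.θ') * δ' := by
      have := hηC
      rwa [le_div_iff₀ (by positivity : (0 : ℝ) < 2 * S.C)] at this
    have h2 : 2 * S.C * η ^ 2 ≤ 2 * S.C * η := mul_le_mul_of_nonneg_left hη2 (by positivity)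
    linarith
  have hηγ' : η < γ := by linarith
  have hηδ' : η ≤ δ' := hηγ'.le.trans hγδ'
  obtain ⟨l₀, hl₀⟩ : ∃ l₀ : ℕ, S.θ' ^ l₀ * S.R ≤ δ' / 2 := by
    obtain ⟨n, hn⟩ := exists_pow_lt_of_lt_one (show 0 < δ' / (2 * S.R) by positivity) hθ1
    refine ⟨n, ?_⟩
    have := (lt_div_iff₀ (by positivity : (0 : ℝ) < 2 * S.R)).1 hn
    linarith
  obtain ⟨N, hN⟩ : ∃ N : ℕ, K * θ₁ ^ N * (2 * δ') ≤ ε := by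
    obtain ⟨N, hN⟩ :=
      exists_pow_lt_of_lt_one (show 0 < ε / (2 * K * δ' + 1) by positivity) hθ₁1
    refine ⟨N, ?_⟩
    have h1 : K * θ₁ ^ N * (2 * δ') ≤ K * (ε / (2 * K * δ' + 1)) * (2 * δ') := by
      gcongr
    refine h1.trans ?_
    rw [show K * (ε / (2 * K * δ' + 1)) * (2 * δ') = ε * (2 * K * δ' / (2 * K * δ' + 1)) by
      ring]
    have h2 : 2 * K * δ' / (2 * K * δ' + 1) ≤ 1 := by
      rw [div_le_one (by positivity)]
      linarith
    have h3 : 0 ≤ 2 * K * δ' / (2 * K * δ' + 1) := by positivity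
    nlinarith
  set g₁ : ℝ := min S.g₀ (η / (2 * Kg ^ (l₀ + N))) with hg₁
  have hg₁pos : 0 < g₁ := lt_min S.g₀_pos (by positivity)
  refine ⟨g₁, hg₁pos, min_le_left _ _, fun g hg => ?_⟩
  have hgpos : 0 < g := hg.1; have hgg₀ : g ≤ S.g₀ := hg.2.trans (min_le_left _ _)
  have hgsmall : g * Kg ^ (l₀ + N) ≤ η / 2 := by
    have : g ≤ η / (2 * Kg ^ (l₀ + N)) := hg.2.trans (min_le_right _ _)
    rw [le_div_iff₀ (by positivity)] at this
    linarith
  have hgpow : ∀ l ≤ l₀ + N, g * Kg ^ l ≤ η / 2 := fun l hl =>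
    (mul_le_mul_of_nonneg_left (pow_le_pow_right₀ hKg1 hl) hgpos.le).trans hgsmall
  have hP1 : ∀ l ≤ l₀, 0 < (S.F^[l] (g, S.yW g)).1 ∧ (S.F^[l] (g, S.yW g)).1 ≤ g * Kg ^ l ∧
      ‖(S.F^[l] (g, S.yW g)).2‖ ≤ S.R ∧
      ‖(S.F^[l] (g, S.yW g)).2‖ ≤ S.θ' ^ l * S.R + δ' / 2 :=
    tvLocal_phase1 S hδ' hδ'δ hηδ' hηγ'.le hc₁b hc₁pos.le hηc' hηC' hgpos hgg₀
      ((hgpow l₀ (Nat.le_add_right _ _)).trans (by linarith))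
  obtain ⟨hq0, hqgrow, -, hqfib⟩ := hP1 l₀ le_rfl
  set q : ℝ × S.E := S.F^[l₀] (g, S.yW g) with hq
  have hqη2 : q.1 ≤ η / 2 := hqgrow.trans (hgpow l₀ (Nat.le_add_right _ _))
  have hqη : q.1 ≤ η := by linarith
  have hqγ : q.1 < γ := by linarith
  have hqδ' : ‖q.2‖ ≤ δ' := by linarith
  have hiter : ∀ i, S.F^[i] q = S.F^[l₀ + i] (g, S.yW g) := by
    intro i
    rw [hq, ← Function.iterate_add_apply, Nat.add_comm]
  have hP2 : ∀ n : ℕ, (∀ i < n, (S.F^[i] q).1 < γ) →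
      0 < (S.F^[n] q).1 ∧ (S.F^[n] q).1 ≤ γ' ∧ ‖(S.F^[n] q).2‖ ≤ δ' ∧
        (S.F^[n] q).1 ≤ q.1 * Kg ^ n ∧ q.1 + n * (S.b / 2 * q.1 ^ 3) ≤ (S.F^[n] q).1 :=
    tvLocal_phase2 S hδ'δ hdriftM hfibM hγγ' hγδ' hc₁b' hq0 (hqγ.le.trans hγγ'lt.le) hqδ'
  have hd : 0 < S.b / 2 * q.1 ^ 3 := by positivity
  have hPass : ∃ l, γ ≤ (S.F^[l] (g, S.yW g)).1 := by
    by_contra hno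
    push Not at hno
    obtain ⟨n, hn⟩ := exists_nat_ge (γ / (S.b / 2 * q.1 ^ 3))
    have hnd : γ ≤ n * (S.b / 2 * q.1 ^ 3) := by rwa [div_le_iff₀ hd] at hn
    have h1 := (hP2 n fun i _ => by rw [hiter]; exact hno (l₀ + i)).2.2.2.2
    have h2 : (S.F^[n] q).1 < γ := by rw [hiter]; exact hno (l₀ + n)
    linarith
  obtain ⟨j, hj, hmin⟩ : ∃ j, γ ≤ (S.F^[j] (g, S.yW g)).1 ∧
      ∀ l < j, (S.F^[l] (g, S.yW g)).1 < γ := by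
    classical
    exact ⟨Nat.find hPass, Nat.find_spec hPass, fun l hl => not_le.1 (Nat.find_min hPass hl)⟩
  have hjl₀ : l₀ < j := by
    by_contra hle
    push Not at hle
    have h1 := ((hP1 j hle).2.1.trans (hgpow j (by omega)))
    linarith
  obtain ⟨n, rfl⟩ : ∃ n, j = l₀ + n := ⟨j - l₀, by omega⟩
  have hPn : ∀ i ≤ n, 0 < (S.F^[i] q).1 ∧ (S.F^[i] q).1 ≤ γ' ∧ ‖(S.F^[i] q).2‖ ≤ δ' ∧
      (S.F^[i] q).1 ≤ q.1 * Kg ^ i ∧ q.1 + i * (S.b / 2 * q.1 ^ 3) ≤ (S.F^[i] q).1 :=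
    fun i hi => hP2 i fun i' hi' => by rw [hiter]; exact hmin (l₀ + i') (by omega)
  have hjq : γ ≤ (S.F^[n] q).1 := by rw [hiter]; exact hj
  have hNn : N < n := by
    by_contra hle
    push Not at hle
    have h1 := (hPn n le_rfl).2.2.2.1
    have h2 : q.1 * Kg ^ n ≤ g * Kg ^ (l₀ + n) :=
      calc q.1 * Kg ^ n ≤ g * Kg ^ l₀ * Kg ^ n := mul_le_mul_of_nonneg_right hqgrow (by positivity)
        _ = g * Kg ^ (l₀ + n) := by ring
    have h3 := hgpow (l₀ + n) (by omega)
    linarith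
  refine ⟨l₀ + n, ?_, hmin, ?_⟩
  · -- in-chart history
    intro i hi
    rcases le_or_gt i l₀ with hil | hil
    · obtain ⟨h0, hgrow, hRi, -⟩ := hP1 i hil
      have h2 := hgrow.trans (hgpow i (by omega))
      exact tvLocal_mem_chart S ⟨h0.le, by linarith⟩ hRi
    · obtain ⟨i', rfl⟩ : ∃ i', i = l₀ + i' := ⟨i - l₀, by omega⟩
      obtain ⟨h0, hγ'i, hδ'i, -, -⟩ := hPn i' (by omega)
      rw [← hiter]
      exact tvLocal_mem_chart S ⟨h0.le, hγ'i.trans (hγ'δ'.trans hδ'δ)⟩ (hδ'i.trans hδ'R)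
  · -- in the tube: window from the first passage and the overshoot, fibre from ATTRACTION
    obtain ⟨-, hγ'n, -, -, -⟩ := hPn n le_rfl
    rw [← hiter]
    simp only [tube, Set.mem_setOf_eq]
    refine ⟨⟨hjq, hγ'n⟩, ?_⟩
    have hseg : ∀ i ≤ n, (S.F^[i] q).1 ∈ Set.Icc 0 δ' ∧ ‖(S.F^[i] q).2‖ ≤ δ' := fun i hi =>
      ⟨⟨(hPn i hi).1.le, (hPn i hi).2.1.trans hγ'δ'⟩, (hPn i hi).2.2.1⟩
    have hatt := hattr q n hseg
    have hq2 : ‖q.2 - h q.1‖ ≤ 2 * δ' := by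
      have h2 : ‖h q.1‖ ≤ δ' / 2 := hhalf _ ⟨hq0.le, hqη.trans hηδ'⟩
      calc ‖q.2 - h q.1‖ ≤ ‖q.2‖ + ‖h q.1‖ := norm_sub_le _ _
        _ ≤ δ' + δ' / 2 := add_le_add hqδ' h2
        _ ≤ 2 * δ' := by linarith
    have hθpow : θ₁ ^ n ≤ θ₁ ^ N := pow_le_pow_of_le_one hθ₁ hθ₁1.le hNn.le
    calc ‖(S.F^[n] q).2 - h (S.F^[n] q).1‖ ≤ K * θ₁ ^ n * ‖q.2 - h q.1‖ := hatt
      _ ≤ K * θ₁ ^ N * (2 * δ') := by gcongr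
      _ ≤ ε := hN

/-- **Stub 2 of `trajectory-gap-scaling`** (λ-lemma): large-`β` Wilson orbits enter the tube. -/
theorem stub_tubeVisited : TubeVisited := by
  intro G _ _ _ _ _ _ r M' S δ' K θ₁ C' h hcd γ γ' ε hγ hγγ' hγ'δ' hε
  obtain ⟨g₁, hg₁, hg₁g₀, horbit⟩ := tubeVisited_orbit S hcd hγ hγγ' hγ'δ' hε
  obtain ⟨B, hB⟩ := tvLocal_exists_wilson_point S hg₁ hg₁g₀
  refine ⟨B, fun β hβ => ?_⟩
  obtain ⟨g, hg, hgβ⟩ := hB β hβ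
  exact ⟨g, ⟨hg.1, hg.2.trans hg₁g₀⟩, hgβ, horbit g hg⟩

end Summit.QuantumFields.YangMills.Cruxes.LatticeGapOnTrajectory.TrajectoryGapScaling

end
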